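import Summits.KontsevichZagierPeriods.Zeta5Search.Barrier.ConeGammaOneForm

/-!
# ζ(5) search — BARRIER: `γ` AS ONE AFFINE FORM ON A BOX — soundness of the one-form checker

HONEST FRAMING (cell `pub-zeta5`): systematic search; no irrationality claim unless kernel-certified. Theorems only.
MODEL functionals `C₁`, `C₀`, `δ₂₈`, `Φ = phi30`, `γ = gamma` of `ConeGammaRates` under Brown–Zudilin's (28)+(30)
((28) observed, not proved); every `γ`-bound obtained from `OneForm.oneFormCheck` is an UPPER bound over its box, above
the centre's pinned value; nothing about the cone's supremum (C2 OPEN), S-E (CONJECTURED), (TD_A) or `ζ(5)`; no number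
of record moves; records in print UNMOVED. Theory seat cert-2 g39 (item «γ AS ONE AFFINE FORM ON A BOX», part 2).

* `frac_le_of_oneForm` — the final algebra `(1 − γ*)C₁ − C₀ − γ*δ + γ*Φ ≤ 0`, `C₀ ≤ C₁`, `γ* ≥ 0 ⇒ γ ≤ γ*`;
* `featVal_centre_expand`, `featVal_centre_eq`, `slope_abs_le` — the affine expansion about the box centre;
* **`gamma_le_of_oneFormCheck`** — `oneFormCheck … = true → BZBox a → (box) → C₁ a ≤ s₀c₁⁺ → s₀c₀⁻ ≤ C₀ a → C₀ a ≤ C₁ a →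
  gamma a ≤ gnum/gden`.
-/

open Finset Set MeasureTheory
open Literature.Analysis.ValidatedNumerics.NumericsMP

namespace Summit.KontsevichZagierPeriods.Zeta5Search.Barrier.ConeGamma

namespace OneForm

open LemmaFBox (SC KT lnNat SC_pos coef featVal minNum maxNum sum8 box centre centre_mem abs_sub_centre_le abs_le_of_mem
  getD_map_range featVal_sub_eq_sum sum8_eq_sum aOfS_normalise box_hyp)
open LemmaFWin (winForm winFormL winFormL_eq_winForm zI mem_zI winEnc winEnc_sound cutsOK sortedLE_spec mems_spec)
open LemmaFWinBox

/-! ### Soundness -/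

/-- The final algebra: from `C₀ ≤ C₁`, `0 ≤ γ*` and `(1 − γ*)·C₁ − C₀ − γ*·δ + γ*·Φ ≤ 0`, `γ = (C₁ − C₀)/(C₁ + δ − Φ) ≤ γ*`
(if the denominator is `≤ 0` the quotient is `≤ 0 ≤ γ*`). -/
theorem frac_le_of_oneForm {C1 C0 δ Φ g : ℝ} (hord : C0 ≤ C1) (hg : 0 ≤ g)
    (hE : (1 - g) * C1 - C0 - g * δ + g * Φ ≤ 0) : (C1 - C0) / (C1 + δ - Φ) ≤ g := by
  have key : C1 - C0 ≤ g * (C1 + δ - Φ) := by linarith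
  rcases le_or_gt (C1 + δ - Φ) 0 with hnp | hpos
  · exact (div_nonpos_of_nonneg_of_nonpos (by linarith) hnp).trans hg
  · rwa [div_le_iff₀ hpos]

/-- `featVal c t = featVal c t_c + Σ_i (t_i − t_{c,i})·coef_i`. -/
theorem featVal_centre_expand (c : List ℤ) (t tc : Fin 8 → ℝ) :
    featVal c t = featVal c tc + ∑ i : Fin 8, (t i - tc i) * (coef c i : ℝ) := by
  rw [← featVal_sub_eq_sum, LemmaFBox.featVal_sub]; ring

/-- `2D·featVal c t_c = cenNum c lo hi`. -/
theorem featVal_centre_eq {D : ℕ} (hD : 0 < D) (c : List ℤ) (lo hi : List ℕ) :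
    featVal c (centre D lo hi) * (2 * D) = (cenNum c lo hi : ℝ) := by
  unfold cenNum
  rw [sum8_eq_sum, featVal, Finset.sum_mul]
  push_cast
  refine Finset.sum_congr rfl fun i _ => ?_
  have hD' : (0 : ℝ) < D := by exact_mod_cast hD
  simp only [centre]
  field_simp

/-- One coordinate of the slope: `|γ*·(v_i − d_i/W)| ≤ γ*·slopeMag_i/(SC·W)` for `v_i ∈ g_i`. -/
theorem slope_abs_le {g : List MI} {d : List ℤ} {W : ℕ} (hW : 0 < W) {v : ℝ} {i : Fin 8}
    (hv : MI.mem SC v (getI g i)) :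
    |v - (coef d i : ℝ) / W| ≤ (slopeMag g d W i : ℝ) / ((SC : ℝ) * W) := by
  have hS : (0 : ℝ) < SC := by exact_mod_cast SC_pos
  have hW' : (0 : ℝ) < W := by exact_mod_cast hW
  rw [le_div_iff₀ (by positivity)]
  have e : |v - (coef d i : ℝ) / W| * ((SC : ℝ) * W) = |v * SC * W - (coef d i : ℝ) * SC| := by
    rw [← abs_of_pos (by positivity : (0 : ℝ) < (SC : ℝ) * W), ← abs_mul]
    congr 1; field_simp
  rw [e]
  obtain ⟨h1, h2⟩ := hv
  unfold slopeMag
  push_cast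
  refine abs_le_max_abs_abs ?_ ?_
  · nlinarith
  · nlinarith

/-- The one-form inequality `gden·A + gnum·B ≤ 0` with the Φ-hull `(I, g)` in hand gives `γ ≤ gnum/gden`. -/
theorem gamma_le_of_AB {lo hi : List ℕ} {D E : ℕ} {cuts : List ℕ} {mems : List (Fin 7 × Fin 7)}
    {Ss : List (List (Fin 28))} {c1hi c0lo : ℤ} {den gnum gden : ℕ}
    (hbox : boxOK8 D lo hi = true) (hcuts : cutsOK E cuts mems = true)
    (hwall : wallOKBox lo hi E (cuts.getD 0 0) D = true) (hden : 0 < den) (hgden : 0 < gden) (hgle : gnum ≤ gden)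
    (hW : 0 < Ss.length) (hSs : ∀ S ∈ Ss, dsetOK S = true) {I : MI} {g : List MI}
    (hh : wboxHullN lo hi D E cuts mems = some (I, g))
    (hineq : (gden : ℤ) * ((c1hi - c0lo) * (Ss.length : ℤ) * (SC : ℤ) * (2 * D))
      + (gnum : ℤ) * (-c1hi * (Ss.length : ℤ) * (SC : ℤ) * (2 * D) - cenNum (mixVec Ss) lo hi * den * (SC : ℤ)
        + I.hi * den * (Ss.length : ℤ) * (2 * D) + slackNum g (mixVec Ss) Ss.length lo hi * den) ≤ 0)
    {a : Dir} (ha : BZBox a)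
    (h : ∀ j : Fin 7, ((lo.getD j.succ 0 : ℕ) : ℝ) ≤ sParam a j.succ / sParam a 0 * D ∧
      sParam a j.succ / sParam a 0 * D ≤ ((hi.getD j.succ 0 : ℕ) : ℝ))
    (hC1 : C1 a ≤ sParam a 0 * ((c1hi : ℝ) / den)) (hC0 : sParam a 0 * ((c0lo : ℝ) / den) ≤ C0 a)
    (hord : C0 a ≤ C1 a) : gamma a ≤ (gnum : ℝ) / gden := by
  obtain ⟨hD, hlo0, hhi0, hle⟩ := boxOK8_spec hbox
  have ht := box_hyp ha ⟨hlo0, hhi0⟩ h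
  have hD' : (0 : ℝ) < D := by exact_mod_cast hD
  have hS : (0 : ℝ) < SC := by exact_mod_cast SC_pos
  have hden' : (0 : ℝ) < den := by exact_mod_cast hden
  have hgden' : (0 : ℝ) < gden := by exact_mod_cast hgden
  have hWr : (0 : ℝ) < Ss.length := by exact_mod_cast hW
  have hs0 : 0 < sParam a 0 := ha.1
  set t : Fin 8 → ℝ := fun i => sParam a i / sParam a 0 with htdef
  set tc := centre D lo hi with htc
  set γs : ℝ := (gnum : ℝ) / gden with hγ
  have hγ0 : 0 ≤ γs := by positivity
  have hγ1 : γs ≤ 1 := by rw [hγ, div_le_one hgden']; exact_mod_cast hgle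
  -- Φ
  obtain ⟨v, hv, hΦ⟩ := phi30_le_hull hbox hcuts hwall hh ha ht
  -- δ
  have htmem : t ∈ box D lo hi := ht
  have hn := aOfS_normalise ha
  have hδ : sParam a 0 * (featVal (mixVec Ss) t / Ss.length) ≤ delta28 a := by
    have e : delta28 a = sParam a 0 * delta28 (aOfS t) := by
      conv_lhs => rw [hn]
      rw [delta28_smul hs0.le]
    rw [e]
    exact mul_le_mul_of_nonneg_left (delta28_ge_mixture hSs hW t) hs0.le
  -- the affine form at `t`, per unit `s₀`
  set d := mixVec Ss with hd
  have hexp := featVal_centre_expand d t tc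
  have hcen := featVal_centre_eq hD d lo hi
  -- slope bound per coordinate
  have hterm : ∀ i : Fin 8, (t i - tc i) * (γs * (v i - (coef d i : ℝ) / Ss.length)) ≤
      (((hi.getD i 0 : ℕ) : ℝ) - ((lo.getD i 0 : ℕ) : ℝ)) / (2 * D) *
        (γs * ((slopeMag g d Ss.length i : ℝ) / ((SC : ℝ) * Ss.length))) := by
    intro i
    refine (le_abs_self _).trans ?_
    rw [abs_mul, abs_mul, abs_of_nonneg hγ0]
    refine mul_le_mul (abs_sub_centre_le hD htmem i) (mul_le_mul_of_nonneg_left (slope_abs_le hW (hv i)) hγ0)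
      (mul_nonneg hγ0 (abs_nonneg _)) ?_
    have : ((lo.getD i 0 : ℕ) : ℝ) ≤ ((hi.getD i 0 : ℕ) : ℝ) := by exact_mod_cast (hle i).1
    exact div_nonneg (by linarith) (by positivity)
  have hslack : ∑ i : Fin 8, (t i - tc i) * (γs * (v i - (coef d i : ℝ) / Ss.length)) ≤
      γs * ((slackNum g d Ss.length lo hi : ℝ) / (2 * D * SC * Ss.length)) := by
    refine (Finset.sum_le_sum fun i _ => hterm i).trans (le_of_eq ?_)
    unfold slackNum
    rw [sum8_eq_sum]; push_cast
    rw [Finset.sum_div, Finset.mul_sum]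
    refine Finset.sum_congr rfl fun i _ => ?_
    field_simp
  -- the integer inequality, as reals, divided by `den·W·SC·2D > 0`
  have hI : ((gden : ℤ) * ((c1hi - c0lo) * (Ss.length : ℤ) * (SC : ℤ) * (2 * D))
      + (gnum : ℤ) * (-c1hi * (Ss.length : ℤ) * (SC : ℤ) * (2 * D) - cenNum d lo hi * den * (SC : ℤ)
        + I.hi * den * (Ss.length : ℤ) * (2 * D) + slackNum g d Ss.length lo hi * den) : ℝ) ≤ 0 := by
    rw [hd]; exact_mod_cast hineq
  push_cast at hI
  have hform : (1 - γs) * ((c1hi : ℝ) / den) - (c0lo : ℝ) / den - γs * (featVal d tc / Ss.length)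
      + γs * ((I.hi : ℝ) / SC) + γs * ((slackNum g d Ss.length lo hi : ℝ) / (2 * D * SC * Ss.length)) ≤ 0 := by
    have hpos : (0 : ℝ) < (den : ℝ) * Ss.length * SC * (2 * D) * gden := by positivity
    have e1 : featVal d tc = (cenNum d lo hi : ℝ) / (2 * D) := by
      rw [← hcen, htc]; field_simp
    rw [e1, hγ]
    have h := div_nonpos_of_nonpos_of_nonneg hI hpos.le
    refine le_trans (le_of_eq ?_) h
    field_simp
    ring
  -- assemble E(a) ≤ s₀ · (form at t) ≤ 0
  have hE : (1 - γs) * C1 a - C0 a - γs * delta28 a + γs * phi30 a ≤ 0 := by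
    have h1 : (1 - γs) * C1 a ≤ (1 - γs) * (sParam a 0 * ((c1hi : ℝ) / den)) :=
      mul_le_mul_of_nonneg_left hC1 (by linarith)
    have h3 : γs * delta28 a ≥ γs * (sParam a 0 * (featVal d t / Ss.length)) := mul_le_mul_of_nonneg_left hδ hγ0
    have h4 : γs * phi30 a ≤ γs * (sParam a 0 * ((I.hi : ℝ) / SC + ∑ i : Fin 8, (t i - tc i) * v i)) :=
      mul_le_mul_of_nonneg_left hΦ hγ0
    by_cases hz : γs = 0
    · -- γ* = 0: the form is the C₁-bound minus the C₀-bound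
      rw [hz] at hform ⊢
      simp only [sub_zero, zero_mul, add_zero, one_mul] at hform ⊢
      have : sParam a 0 * ((c1hi : ℝ) / den) - sParam a 0 * ((c0lo : ℝ) / den) ≤ 0 := by
        rw [← mul_sub]; exact mul_nonpos_of_nonneg_of_nonpos hs0.le (by linarith)
      linarith
    · have hsum : ∑ i : Fin 8, (t i - tc i) * v i - (∑ i : Fin 8, (t i - tc i) * (coef d i : ℝ)) / Ss.length
          = (∑ i : Fin 8, (t i - tc i) * (γs * (v i - (coef d i : ℝ) / Ss.length))) / γs := by
        rw [eq_div_iff hz, Finset.sum_div, ← Finset.sum_sub_distrib, Finset.sum_mul]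
        exact Finset.sum_congr rfl fun i _ => by ring
      have e : (1 - γs) * (sParam a 0 * ((c1hi : ℝ) / den)) - sParam a 0 * ((c0lo : ℝ) / den)
          - γs * (sParam a 0 * ((featVal d tc + ∑ i : Fin 8, (t i - tc i) * (coef d i : ℝ)) / Ss.length))
          + γs * (sParam a 0 * ((I.hi : ℝ) / SC + ∑ i : Fin 8, (t i - tc i) * v i))
          = sParam a 0 * ((1 - γs) * ((c1hi : ℝ) / den) - (c0lo : ℝ) / den - γs * (featVal d tc / Ss.length)
            + γs * ((I.hi : ℝ) / SC)
            + ∑ i : Fin 8, (t i - tc i) * (γs * (v i - (coef d i : ℝ) / Ss.length))) := by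
        have : ∑ i : Fin 8, (t i - tc i) * (γs * (v i - (coef d i : ℝ) / Ss.length))
            = γs * (∑ i : Fin 8, (t i - tc i) * v i - (∑ i : Fin 8, (t i - tc i) * (coef d i : ℝ)) / Ss.length) := by
          rw [hsum, ← mul_div_assoc, mul_div_cancel_left₀ _ hz]
        rw [this]; ring
      have key : (1 - γs) * (sParam a 0 * ((c1hi : ℝ) / den)) - sParam a 0 * ((c0lo : ℝ) / den)
          - γs * (sParam a 0 * (featVal d t / Ss.length))
          + γs * (sParam a 0 * ((I.hi : ℝ) / SC + ∑ i : Fin 8, (t i - tc i) * v i)) ≤ 0 := by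
        rw [hexp, e]
        exact mul_nonpos_of_nonneg_of_nonpos hs0.le (by linarith)
      linarith
  unfold gamma
  exact frac_le_of_oneForm hord hγ0 hE

/-- **SOUNDNESS OF THE ONE-FORM CHECK.** If `oneFormCheck … = true` then for EVERY direction `a` of the closed box whose
normalised parameters lie in the box, `C₁(a) ≤ s₀·c₁⁺/den`, `s₀·c₀⁻/den ≤ C₀(a)` and `C₀(a) ≤ C₁(a)` imply
`γ(a) ≤ gnum/gden`. (MODEL `gamma` under (28)+(30); an upper bound over the box; nothing about the cone's supremum.) -/
theorem gamma_le_of_oneFormCheck {lo hi : List ℕ} {D E : ℕ} {cuts : List ℕ} {mems : List (Fin 7 × Fin 7)}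
    {Ss : List (List (Fin 28))} {c1hi c0lo : ℤ} {den gnum gden : ℕ}
    (hc : oneFormCheck lo hi D E cuts mems Ss c1hi c0lo den gnum gden = true) {a : Dir} (ha : BZBox a)
    (h : ∀ j : Fin 7, ((lo.getD j.succ 0 : ℕ) : ℝ) ≤ sParam a j.succ / sParam a 0 * D ∧
      sParam a j.succ / sParam a 0 * D ≤ ((hi.getD j.succ 0 : ℕ) : ℝ))
    (hC1 : C1 a ≤ sParam a 0 * ((c1hi : ℝ) / den)) (hC0 : sParam a 0 * ((c0lo : ℝ) / den) ≤ C0 a)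
    (hord : C0 a ≤ C1 a) : gamma a ≤ (gnum : ℝ) / gden := by
  unfold oneFormCheck at hc
  simp only [Bool.and_eq_true, decide_eq_true_eq, List.all_eq_true] at hc
  obtain ⟨⟨⟨⟨⟨⟨⟨⟨hbox, hcuts⟩, hwall⟩, hden⟩, hgden⟩, hgle⟩, hW⟩, hSs⟩, hineq⟩ := hc
  unfold oneFormAB at hineq
  split at hineq
  · rename_i A B hAB
    rw [decide_eq_true_eq] at hineq
    split at hAB
    · rename_i I g hh
      simp only [Option.some.injEq, Prod.mk.injEq] at hAB
      obtain ⟨rfl, rfl⟩ := hAB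
      exact gamma_le_of_AB hbox hcuts hwall hden hgden hgle hW hSs hh hineq ha h hC1 hC0 hord
    · simp at hAB
  · simp at hineq

end OneForm

end Summit.KontsevichZagierPeriods.Zeta5Search.Barrier.ConeGamma
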